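import Literature.Computability.Cryptography.RegevSamplerClassical
import Literature.Computability.QuantumComplexity.TidyBlockFnStage
import HarnessLib

/-!
# Regev 2009, Lemma 3.14 in machine form: the `CVP` subroutine placed in the two oracle slots of the classical stage

Topic `Computability/Cryptography` (family `pqc`), grouping namespace `Regev2009.SamplerSubst`; sequel of
`RegevSamplerClassical.lean` (the classical stage `O·C_X·O·C_S·C_Y` of Regev's sampler over a `Layout`: zones
`X, U, Y, S, A`, the query `qry` = input prefix + residue table, the abstract oracle action `oracleAct f`,
the label action `kappa f`, `isBasisMap_stageMat`) and of `QuantumComplexity/TidyBlockFnStage.lean` (the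
register hypotheses `TidyBlockFn.StageHyps` under which the placed tidy block `T_E` of a bounded-error
subroutine may replace the ideal gate `(U_f)_E` in both slots at cost `4√(Σ_x errFn(q(x))|a(x)|²)` on a
superposition of labels — Bennett–Bernstein–Brassard–Vazirani 1997, Thm. 4.14 with Thm. 3.3). Regev
(J. ACM 56 (2009), art. 34, proof of Lemma 3.3 with Lemma 3.14): the `CVP` oracle of the sampler is the
classical procedure of Lemma 3.4 using the `LWE` oracle — a bounded-error quantum family `R` once the
`LWE` oracle is a quantum machine; in the tree's model its circuit `R.circ k_q` with `d` ancillas runs, in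
BBBV's tidy block (copy the query, run, copy the answer, un-run, un-copy), on `k_q + n·b_c + (k_q + d)`
wires PLACED in the big register. This file fixes the placement and discharges the register hypotheses:

* `SubZone Λ d` — the subroutine's own register: `k_q + d` wires off the zones (an injective placement);
* `qryWire` (`qry Λ z i = z (qryWire Λ i)`), **`subE`** — the placement
  `E : Fin (k_q + n·b_c + (k_q + d)) ↪ Fin W`: query wires ↦ the input prefix and the residue zone, answer
  wires ↦ the answer zone, subroutine wires ↦ the sub-zone (`subE_qW`, `subE_aW`, `subE_dE`, injectivity
  from `Layout.OK`);
* `queryOf_subE` (`TidyBlockFn.queryOf E = qry Λ`), **`kappaO_subE`** (the placed ideal gate `(U_f)_E` acts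
  on labels EXACTLY as the abstract oracle `oracleAct Λ f` of `RegevSamplerClassical`), **`kappaSt_subE`**
  (`TidyBlockFn.kappaSt E f κ_X κ_S κ_Y = kappa Λ f`), `stage_eq_stageMat` (the five-factor stage of
  `TidyBlockFnPlaced` IS `stageMat`);
* **`stageHyps`** — `TidyBlockFn.StageHyps E f C_X C_S C_Y κ_X κ_S κ_Y T lab₀` for the compiled blocks
  `circX/circS/circY` and their label actions, for every family of initial labels `lab₀` vanishing on the
  sub-zone: the blocks are unitary basis maps (`CleanXor.isBasisMap_circuit`), the sub-zone is never a
  target of a block nor an answer wire, so it stays clean along the ideal run (`CleanXor.clEval_ops_of_ne`,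
  `kappaO_dE`), and the erasing block writes the point zone only (`qX`);
* `qry_clEval_opsX`, `qry_oracleAct`, **`qry_kappa`** — the query read off the FINAL label of the ideal run
  is the query at the first call (neither the oracle nor the erasing block touches the prefix or the
  residue zone), so the substitution cost is a function of the final labels, which `kappa_spec` describes.

Everything is proved; definitions have bodies; no named fact is introduced.

## References

* O. Regev, *On lattices, learning with errors, random linear codes, and cryptography*, J. ACM 56
  (2009), art. 34; author's version arXiv:2401.03703: Lemma 3.3 (proof), Lemma 3.14 (proof)
  [Regev2009].
* C. H. Bennett, E. Bernstein, G. Brassard, U. Vazirani, *Strengths and weaknesses of quantum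
  computing*, SIAM J. Comput. 26 (1997) 1510–1523, Thm. 4.14 [BennettBernsteinBrassardVazirani1997].
* M. A. Nielsen, I. L. Chuang, *Quantum Computation and Quantum Information*, CUP 2010, §3.2.5,
  §6.1.1 [NielsenChuang2010].
-/

noncomputable section

namespace Literature.Computability.Cryptography

namespace Regev2009

namespace SamplerSubst

open Finset _root_.Matrix Literature.Computability.Complexity Literature.Computability.QuantumComplexity SamplerClassical
  _root_.Computability

variable {W n : ℕ} (Λ : SamplerClassical.Layout W n)

/-! ### The sub-zone and the placement -/

/-- **The subroutine's own register**: `k_q + d` wires, injectively placed off the zones.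
[cite: BennettBernsteinBrassardVazirani1997, Thm. 4.14 (the subroutine's wires)] -/
structure SubZone (d : ℕ) where
  /-- the placement of the subroutine wires -/
  dirt : Fin (Λ.kq + d) ↪ Fin W
  /-- off the zones -/
  off : ∀ (t : Fin (Λ.kq + d)) (i : ℕ), i < Λ.T → dirt t ≠ Λ.fin i

/-- The zone index of query wire `i`: inside the input prefix, then inside the residue zone. [folklore] -/
def qryIdx (i : Fin Λ.kq) : ℕ := if (i : ℕ) < Λ.Lq then Λ.oU + i else Λ.oS + ((i : ℕ) - Λ.Lq)

/-- **The wire holding query bit `i`.** [cite: Regev2009, Lemma 3.14 (proof)] -/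
def qryWire (i : Fin Λ.kq) : Fin W := Λ.fin (qryIdx Λ i)

/-- The query read off a label is the content of the query wires. [folklore] -/
theorem qry_apply (z : QReg W) (i : Fin Λ.kq) : qry Λ z i = z (qryWire Λ i) := by
  unfold qry qryWire qryIdx
  split_ifs <;> rfl

/-- The offsets of a layout, unfolded. [folklore] -/
theorem offsets_eq : Λ.oU = n * Λ.ℓ ∧ Λ.oY = Λ.oU + Λ.L ∧ Λ.oS = Λ.oY + n * Λ.ℓY ∧ Λ.oA = Λ.oS + n * Λ.ℓR ∧
    Λ.T = Λ.oA + n * Λ.bc ∧ Λ.kq = Λ.Lq + n * Λ.ℓR := ⟨rfl, rfl, rfl, rfl, rfl, rfl⟩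

/-- Where the zone index of a query wire lies. [folklore] -/
theorem qryIdx_cases (i : Fin Λ.kq) :
    (Λ.oU ≤ qryIdx Λ i ∧ qryIdx Λ i < Λ.oU + Λ.Lq) ∨ (Λ.oS ≤ qryIdx Λ i ∧ qryIdx Λ i < Λ.oS + n * Λ.ℓR) := by
  have hi := i.isLt
  have hk := (offsets_eq Λ).2.2.2.2.2
  unfold qryIdx
  split_ifs with h
  · exact Or.inl ⟨Nat.le_add_right _ _, by omega⟩
  · exact Or.inr ⟨Nat.le_add_right _ _, by omega⟩

variable {Λ}

/-- The zone index of a query wire is a zone index. [folklore] -/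
theorem qryIdx_lt_T (hΛ : Λ.OK) (i : Fin Λ.kq) : qryIdx Λ i < Λ.T := by
  have hLq := hΛ.Lq_le
  obtain ⟨h1, h2, h3, h4, h5, h6⟩ := offsets_eq Λ
  rcases qryIdx_cases Λ i with ⟨-, h⟩ | ⟨-, h⟩ <;> omega

/-- `qryIdx` is injective (the prefix is a prefix of the input zone). [folklore] -/
theorem qryIdx_injective (hΛ : Λ.OK) : Function.Injective (qryIdx Λ) := by
  intro i j h
  have hi := i.isLt; have hj := j.isLt
  have hLq := hΛ.Lq_le
  obtain ⟨h1, h2, h3, h4, h5, h6⟩ := offsets_eq Λ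
  apply Fin.ext
  unfold qryIdx at h
  split_ifs at h <;> omega

/-- A query wire is not an answer wire. [folklore] -/
theorem qryWire_ne_answer (hΛ : Λ.OK) (i : Fin Λ.kq) (j : Fin (n * Λ.bc)) : qryWire Λ i ≠ Λ.fin (Λ.oA + j) := by
  intro h
  have hLq := hΛ.Lq_le
  obtain ⟨h1, h2, h3, h4, h5, h6⟩ := offsets_eq Λ
  have := Layout.fin_inj hΛ (qryIdx_lt_T hΛ i) (by omega) h
  rcases qryIdx_cases Λ i with ⟨-, h⟩ | ⟨-, h⟩ <;> omega

/-- A query wire is not a point wire. [folklore] -/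
theorem qryWire_ne_point (hΛ : Λ.OK) (i : Fin Λ.kq) {j : ℕ} (hj : j < n * Λ.ℓ) : qryWire Λ i ≠ Λ.fin j := by
  intro h
  have hLq := hΛ.Lq_le
  obtain ⟨h1, h2, h3, h4, h5, h6⟩ := offsets_eq Λ
  have := Layout.fin_inj hΛ (qryIdx_lt_T hΛ i) (by omega) h
  rcases qryIdx_cases Λ i with ⟨h', -⟩ | ⟨h', -⟩ <;> omega

/-- A query wire is not a zone wire of index in `[n·ℓ + L, oS)` (the branch zone) nor `≥ oA`. [folklore] -/
theorem qryIdx_not_branch (hΛ : Λ.OK) (i : Fin Λ.kq) : qryIdx Λ i < Λ.oY ∨ (Λ.oS ≤ qryIdx Λ i ∧ qryIdx Λ i < Λ.oA) := by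
  have hLq := hΛ.Lq_le
  obtain ⟨h1, h2, h3, h4, h5, h6⟩ := offsets_eq Λ
  rcases qryIdx_cases Λ i with ⟨-, h⟩ | ⟨h', h⟩
  · exact Or.inl (by omega)
  · exact Or.inr ⟨h', by omega⟩

variable (hΛ : Λ.OK)

/-- **The placement of the tidy block**: query wires, answer wires, subroutine wires.
[cite: BennettBernsteinBrassardVazirani1997, Thm. 4.14] [cite: Regev2009, Lemma 3.14 (proof)] -/
def subE {d : ℕ} (Z : SubZone Λ d) : Fin (TidyBlockFn.W Λ.kq (n * Λ.bc) d) ↪ Fin W where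
  toFun w :=
    if h : (w : ℕ) < Λ.kq then qryWire Λ ⟨w, h⟩
    else if h' : (w : ℕ) < Λ.kq + n * Λ.bc then Λ.fin (Λ.oA + ((w : ℕ) - Λ.kq))
    else Z.dirt ⟨(w : ℕ) - (Λ.kq + n * Λ.bc), by have := w.isLt; simp only [TidyBlockFn.W] at this; omega⟩
  inj' := by
    intro w w' hww
    obtain ⟨h1, h2, h3, h4, h5, h6⟩ := offsets_eq Λ
    have hLq := hΛ.Lq_le
    have hw := w.isLt; have hw' := w'.isLt
    simp only [TidyBlockFn.W] at hw hw'
    apply Fin.ext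
    dsimp only at hww
    by_cases h1w : (w : ℕ) < Λ.kq <;> by_cases h1w' : (w' : ℕ) < Λ.kq
    · rw [dif_pos h1w, dif_pos h1w'] at hww
      have := Fin.ext_iff.1 (qryIdx_injective hΛ (Layout.fin_inj hΛ (qryIdx_lt_T hΛ _) (qryIdx_lt_T hΛ _) hww))
      simpa using this
    · rw [dif_pos h1w, dif_neg h1w'] at hww
      by_cases h2' : (w' : ℕ) < Λ.kq + n * Λ.bc
      · rw [dif_pos h2'] at hww
        have := Layout.fin_inj hΛ (qryIdx_lt_T hΛ _) (by omega) hww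
        rcases qryIdx_cases Λ ⟨w, h1w⟩ with ⟨-, h⟩ | ⟨-, h⟩ <;> omega
      · rw [dif_neg h2'] at hww
        exact absurd hww.symm (Z.off _ _ (qryIdx_lt_T hΛ _))
    · rw [dif_neg h1w, dif_pos h1w'] at hww
      by_cases h2 : (w : ℕ) < Λ.kq + n * Λ.bc
      · rw [dif_pos h2] at hww
        have := Layout.fin_inj hΛ (by omega) (qryIdx_lt_T hΛ _) hww
        rcases qryIdx_cases Λ ⟨w', h1w'⟩ with ⟨-, h⟩ | ⟨-, h⟩ <;> omega
      · rw [dif_neg h2] at hww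
        exact absurd hww (Z.off _ _ (qryIdx_lt_T hΛ _))
    · rw [dif_neg h1w, dif_neg h1w'] at hww
      by_cases h2 : (w : ℕ) < Λ.kq + n * Λ.bc <;> by_cases h2' : (w' : ℕ) < Λ.kq + n * Λ.bc
      · rw [dif_pos h2, dif_pos h2'] at hww
        have := Layout.fin_inj hΛ (by omega) (by omega) hww
        omega
      · rw [dif_pos h2, dif_neg h2'] at hww
        exact absurd hww.symm (Z.off _ _ (by omega))
      · rw [dif_neg h2, dif_pos h2'] at hww
        exact absurd hww (Z.off _ _ (by omega))
      · rw [dif_neg h2, dif_neg h2'] at hww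
        have := Fin.ext_iff.1 (Z.dirt.injective hww)
        simp only at this
        omega

variable {d : ℕ} (Z : SubZone Λ d)

/-- The placement on a query wire. [folklore] -/
theorem subE_qW (i : Fin Λ.kq) : subE hΛ Z (TidyBlockFn.qW i) = qryWire Λ i := by
  show (if h : ((TidyBlockFn.qW (ℓ := n * Λ.bc) (d := d) i : Fin _) : ℕ) < Λ.kq then _ else _) = _
  rw [dif_pos (by rw [TidyBlockFn.val_qW]; exact i.isLt)]
  rfl

/-- The placement on an answer wire. [folklore] -/
theorem subE_aW (j : Fin (n * Λ.bc)) : subE hΛ Z (TidyBlockFn.aW j) = Λ.fin (Λ.oA + j) := by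
  show (if h : ((TidyBlockFn.aW (k := Λ.kq) (d := d) j : Fin _) : ℕ) < Λ.kq then _ else _) = _
  rw [dif_neg (by rw [TidyBlockFn.val_aW]; omega), dif_pos (by rw [TidyBlockFn.val_aW]; omega), TidyBlockFn.val_aW,
    Nat.add_sub_cancel_left]

/-- The placement on a subroutine wire. [folklore] -/
theorem subE_dE (t : Fin (Λ.kq + d)) : subE hΛ Z (TidyBlockFn.dE Λ.kq (n * Λ.bc) d t) = Z.dirt t := by
  show (if h : ((TidyBlockFn.dE Λ.kq (n * Λ.bc) d t : Fin _) : ℕ) < Λ.kq then _ else _) = _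
  rw [dif_neg (by rw [TidyBlockFn.val_dE]; omega), dif_neg (by rw [TidyBlockFn.val_dE]; omega)]
  congr 1
  exact Fin.ext (by simp [TidyBlockFn.val_dE])

/-- A placed wire of index `≥ k_q + n·b_c` is a subroutine wire. [folklore] -/
theorem subE_of_ge (w : Fin (TidyBlockFn.W Λ.kq (n * Λ.bc) d)) (hw : Λ.kq + n * Λ.bc ≤ (w : ℕ)) :
    ∃ t : Fin (Λ.kq + d), subE hΛ Z w = Z.dirt t := by
  refine ⟨⟨(w : ℕ) - (Λ.kq + n * Λ.bc), by have := w.isLt; unfold TidyBlockFn.W at this; omega⟩, ?_⟩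
  show (if h : ((w : Fin _) : ℕ) < Λ.kq then _ else _) = _
  rw [dif_neg (by omega), dif_neg (by omega)]

/-- **The query through the placement is the query of the layout.** [folklore] -/
theorem queryOf_subE (z : QReg W) : TidyBlockFn.queryOf (subE hΛ Z) z = qry Λ z := by
  funext i
  rw [TidyBlockFn.queryOf_apply, subE_qW hΛ Z, qry_apply]

/-- The answer wires are in the image of the placement. [folklore] -/
theorem answer_mem_range (j : Fin (n * Λ.bc)) : Λ.fin (Λ.oA + j) ∈ Set.range (subE hΛ Z) :=
  ⟨TidyBlockFn.aW j, subE_aW hΛ Z j⟩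

/-- **The placed ideal gate acts as the abstract oracle**: `kappaO (subE Z) f = oracleAct Λ f`.
[cite: NielsenChuang2010, §6.1.1] -/
theorem kappaO_subE (fn : QReg Λ.kq → QReg (n * Λ.bc)) : TidyBlockFn.kappaO (subE hΛ Z) fn = oracleAct Λ fn := by
  obtain ⟨h1, h2, h3, h4, h5, h6⟩ := offsets_eq Λ
  funext z w
  by_cases hw : w ∈ Set.range (subE hΛ Z)
  · obtain ⟨v, rfl⟩ := hw
    rcases TidyBlockFn.wire_cases v with ⟨i, rfl⟩ | ⟨i, rfl⟩ | ⟨j, rfl⟩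
    · have hne : ∀ j : Fin (n * Λ.bc), subE hΛ Z (TidyBlockFn.qW i) ≠ Λ.fin (Λ.oA + j) := by
        rw [subE_qW hΛ Z]; exact qryWire_ne_answer hΛ i
      rw [TidyBlockFn.kappaO_qW, oracleAct_of_ne _ _ _ hne]
    · rw [TidyBlockFn.kappaO_aW, subE_aW hΛ Z, oracleAct_answer hΛ, queryOf_subE hΛ Z]
    · have hne : ∀ j' : Fin (n * Λ.bc), subE hΛ Z (TidyBlockFn.dE Λ.kq (n * Λ.bc) d j) ≠ Λ.fin (Λ.oA + j') := by
        rw [subE_dE hΛ Z]; exact fun j' => Z.off j _ (by omega)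
      rw [TidyBlockFn.kappaO_dE, oracleAct_of_ne _ _ _ hne]
  · have hne : ∀ j : Fin (n * Λ.bc), w ≠ Λ.fin (Λ.oA + j) := fun j hj =>
      hw ⟨TidyBlockFn.aW j, (subE_aW hΛ Z j).trans hj.symm⟩
    rw [TidyBlockFn.kappaO_of_notMem _ _ _ hw, oracleAct_of_ne _ _ _ hne]

/-- **The label action of the ideal stage is `kappa`.** [cite: Regev2009, Lemma 3.14 (proof)] -/
theorem kappaSt_subE (fn : QReg Λ.kq → QReg (n * Λ.bc)) :
    TidyBlockFn.kappaSt (subE hΛ Z) fn (clEval (opsX Λ)) (clEval (opsS Λ)) (clEval (opsY Λ)) = kappa Λ fn := by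
  funext z
  simp only [TidyBlockFn.kappaSt, kappa, Function.comp_apply, kappaO_subE]

variable (hF : Fits Λ)

/-- The five-factor stage of `TidyBlockFnPlaced` is `stageMat`. [folklore] -/
theorem stage_eq_stageMat (O : Matrix (QReg W) (QReg W) ℂ) :
    TidyBlockFn.stage ((circX hΛ hF).toMatrix 0) ((circS hΛ hF).toMatrix 0) ((circY hΛ hF).toMatrix 0) O = stageMat hΛ hF O :=
  rfl

/-! ### The register hypotheses -/

include hΛ hF in
/-- The branch block keeps every wire off the branch zone. [folklore] -/
theorem clEval_opsY_of_ne (z : QReg W) (w : Fin W) (hw : ∀ j, j < n * Λ.ℓY → w ≠ Λ.fin (Λ.oY + j)) :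
    clEval (opsY Λ) z w = z w :=
  CleanXor.clEval_ops_of_ne (geomY hΛ hF) z w hw

include hΛ hF in
/-- The residue block keeps every wire off the residue zone. [folklore] -/
theorem clEval_opsS_of_ne (z : QReg W) (w : Fin W) (hw : ∀ j, j < n * Λ.ℓR → w ≠ Λ.fin (Λ.oS + j)) :
    clEval (opsS Λ) z w = z w :=
  CleanXor.clEval_ops_of_ne (geomS hΛ hF) z w hw

include hΛ hF in
/-- The erasing block keeps every wire off the point zone. [folklore] -/
theorem clEval_opsX_of_ne (z : QReg W) (w : Fin W) (hw : ∀ j, j < n * Λ.ℓ → w ≠ Λ.fin j) :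
    clEval (opsX Λ) z w = z w :=
  CleanXor.clEval_ops_of_ne (geomX hΛ hF) z w hw

include hΛ hF in
/-- The sub-zone is kept by the three blocks. [folklore] -/
theorem blocks_dirt (z : QReg W) (t : Fin (Λ.kq + d)) :
    clEval (opsY Λ) z (Z.dirt t) = z (Z.dirt t) ∧ clEval (opsS Λ) z (Z.dirt t) = z (Z.dirt t) ∧
      clEval (opsX Λ) z (Z.dirt t) = z (Z.dirt t) := by
  obtain ⟨h1, h2, h3, h4, h5, h6⟩ := offsets_eq Λ
  exact ⟨clEval_opsY_of_ne hΛ hF z _ fun j hj => Z.off t _ (by omega),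
    clEval_opsS_of_ne hΛ hF z _ fun j hj => Z.off t _ (by omega),
    clEval_opsX_of_ne hΛ hF z _ fun j hj => Z.off t _ (by omega)⟩

/-- A label vanishing on the sub-zone is clean on the placement. [folklore] -/
theorem mem_cleanOn_of_dirt {z : QReg W} (hz : ∀ t, z (Z.dirt t) = false) : z ∈ TidyBlockFn.CleanOn (subE hΛ Z) := by
  rw [TidyBlockFn.mem_cleanOn_iff]
  intro w hw
  obtain ⟨t, ht⟩ := subE_of_ge hΛ Z w hw
  rw [ht]
  exact hz t

/-- **The register hypotheses of the substitution hold for the sampler's classical stage**, for every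
family of initial labels vanishing on the sub-zone. [cite: Regev2009, Lemma 3.14 (proof)]
[cite: BennettBernsteinBrassardVazirani1997, Thm. 4.14] -/
theorem stageHyps {ι : Type*} (T : Finset ι) (lab₀ : ι → QReg W) (hlab : ∀ x ∈ T, ∀ t, lab₀ x (Z.dirt t) = false)
    (fn : QReg Λ.kq → QReg (n * Λ.bc)) :
    TidyBlockFn.StageHyps (subE hΛ Z) fn ((circX hΛ hF).toMatrix 0) ((circS hΛ hF).toMatrix 0) ((circY hΛ hF).toMatrix 0)
      (clEval (opsX Λ)) (clEval (opsS Λ)) (clEval (opsY Λ)) T lab₀ := by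
  have h1 : ∀ x ∈ T, ∀ t, clEval (opsS Λ) (clEval (opsY Λ) (lab₀ x)) (Z.dirt t) = false := fun x hx t => by
    rw [(blocks_dirt hΛ Z hF _ t).2.1, (blocks_dirt hΛ Z hF _ t).1, hlab x hx t]
  exact
    { bmX := by unfold circX; exact CleanXor.isBasisMap_circuit (geomX hΛ hF)
      bmS := by unfold circS; exact CleanXor.isBasisMap_circuit (geomS hΛ hF)
      bmY := by unfold circY; exact CleanXor.isBasisMap_circuit (geomY hΛ hF)
      uX := by unfold circX; exact CleanXor.circuit_mem_unitaryGroup (geomX hΛ hF)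
      uS := by unfold circS; exact CleanXor.circuit_mem_unitaryGroup (geomS hΛ hF)
      uY := by unfold circY; exact CleanXor.circuit_mem_unitaryGroup (geomY hΛ hF)
      clean₁ := fun x hx => mem_cleanOn_of_dirt hΛ Z (h1 x hx)
      clean₂ := fun x hx => mem_cleanOn_of_dirt hΛ Z fun t => by
        rw [(blocks_dirt hΛ Z hF _ t).2.2, ← subE_dE hΛ Z t, TidyBlockFn.kappaO_dE, subE_dE hΛ Z, h1 x hx t]
      qX := fun w i => by
        rw [subE_qW hΛ Z]
        exact clEval_opsX_of_ne hΛ hF w _ fun j hj => qryWire_ne_point hΛ i hj }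

/-! ### The query read off the final label -/

include hΛ hF in
/-- The erasing block keeps the query. [folklore] -/
theorem qry_clEval_opsX (z : QReg W) : qry Λ (clEval (opsX Λ) z) = qry Λ z := by
  funext i
  rw [qry_apply, qry_apply]
  exact clEval_opsX_of_ne hΛ hF z _ fun j hj => qryWire_ne_point hΛ i hj

include hΛ in
/-- The oracle keeps the query. [folklore] -/
theorem qry_oracleAct (fn : QReg Λ.kq → QReg (n * Λ.bc)) (z : QReg W) : qry Λ (oracleAct Λ fn z) = qry Λ z := by
  funext i
  rw [qry_apply, qry_apply]
  exact oracleAct_of_ne _ _ _ (qryWire_ne_answer hΛ i)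

include hΛ hF in
/-- **The query at the first call is read off the final label.** [cite: Regev2009, Lemma 3.14 (proof: "uncompute the first register" — the query is untouched)] -/
theorem qry_kappa (fn : QReg Λ.kq → QReg (n * Λ.bc)) (z : QReg W) :
    qry Λ (kappa Λ fn z) = qry Λ (clEval (opsS Λ) (clEval (opsY Λ) z)) := by
  simp only [kappa, Function.comp_apply]
  rw [qry_oracleAct hΛ, qry_clEval_opsX hΛ hF, qry_oracleAct hΛ]

/-- **The substitution error of the sampler's stage**, on a superposition of initial labels vanishing on
the sub-zone with injective final labels: `‖stageMat(T_E) Φ − stageMat((U_f)_E) Φ‖₂ ≤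
4 √(Σ_{x ∈ T} errFn_f(Sub)(qry (kappa f (lab₀ x))) · |a(x)|²)`. [cite: BennettBernsteinBrassardVazirani1997, Thm. 3.3 with Thm. 4.14]
[cite: Regev2009, Lemma 3.14 (proof)] -/
theorem l2Norm_stageMat_sum_sub_le {ι : Type*} (T : Finset ι) (lab₀ : ι → QReg W)
    (hlab : ∀ x ∈ T, ∀ t, lab₀ x (Z.dirt t) = false) (fn : QReg Λ.kq → QReg (n * Λ.bc))
    (hinj : Set.InjOn (kappa Λ fn ∘ lab₀) T) (a : ι → ℂ) (Sub : QCircuit cliffordT (Λ.kq + d)) :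
    l2Norm (stageMat hΛ hF (placeGate (subE hΛ Z) (TidyBlockFn.tidyCirc Sub).mat) *ᵥ (∑ x ∈ T, a x • basisState (lab₀ x)) -
        stageMat hΛ hF (placeGate (subE hΛ Z) (TidyBlockFn.idealFn fn)) *ᵥ (∑ x ∈ T, a x • basisState (lab₀ x))) ≤
      4 * Real.sqrt (∑ x ∈ T, TidyBlockFn.errFn fn Sub (qry Λ (kappa Λ fn (lab₀ x))) * ‖a x‖ ^ 2) := by
  have h := TidyBlockFn.l2Norm_stage_sum_sub_le (stageHyps hΛ Z hF T lab₀ hlab fn) (by rw [kappaSt_subE]; exact hinj) a Sub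
  rw [stage_eq_stageMat, stage_eq_stageMat,
    Finset.sum_congr rfl fun x (_ : x ∈ T) =>
      show TidyBlockFn.errFn fn Sub (TidyBlockFn.queryOf (subE hΛ Z) (clEval (opsS Λ) (clEval (opsY Λ) (lab₀ x)))) * ‖a x‖ ^ 2 =
          TidyBlockFn.errFn fn Sub (qry Λ (kappa Λ fn (lab₀ x))) * ‖a x‖ ^ 2 by
        rw [queryOf_subE hΛ Z, qry_kappa hΛ hF]] at h
  exact h

end SamplerSubst

end Regev2009

end Literature.Computability.Cryptography

end
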